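import Literature.NumberTheory.Sieve.TernaryDivisorAPCompletion
import HarnessLib

/-!
# Deligne's bound `|K₂(a; p)| ≤ 3p` for the hyper-Kloosterman sum at primes — the named fact

Topic `Literature/NumberTheory/Sieve`. ONE named fact (D-0014), no proofs:
`Deligne1977_K2_prime_bound`, VERBATIM the hypothesis binder `hD` of the accepted reduction
`Literature.NumberTheory.Sieve.FouvryTenenbaum2021_lemma413_of_deligne_birchBombieri`
(`FouvryTenenbaumDivisorAPLemma413DeligneBB.lean`, p116194) — librarian sweep g24, vend-from-binder,
promote event 3359020 (the provefact seat may not mint it, `lint.fact-fanout`). Companion: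
`BirchBombieriSum.lean` (binder `hBB`). With both, `FouvryTenenbaum2021_lemma413` is the term
`…_of_deligne_birchBombieri hD hC hBB`.

## Source and reading

Heath-Brown, *The divisor function `d₃(n)` in arithmetic progressions*, Acta Arith. 47 (1986), §3,
(3.1) (p. 35): for the multiple Kloosterman sum
`Kₙ(a; q) = ∑*_{x₁⋯x_{n+1} ≡ 1 (q)} e_q(a₁x₁ + … + a_{n+1}x_{n+1})` one has, at a PRIME modulus `q = p`
with `p ∤ a₁⋯a_{n+1}`, `|Kₙ(a; p)| ≤ (n + 1) p^{n/2}` — "This is due to Deligne" (Smith 1979, Thm. 6,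
deduces it from Deligne, SGA 4½, *Sommes trigonométriques*, §7); here `n = 2`:
`|K₂(a; p)| ≤ 3p`. The tree's `HeathBrown1986.K2 p a₁ a₂ a₃ = ∑*_{x,y} e_p(a₁x + a₂y + a₃ x̄ȳ)`
(`TernaryDivisorAPCompletion.lean`) is `K₂` with `x₃ = (x₁x₂)⁻¹` eliminated. The bound is ℓ-adic
(weights of the Kloosterman sheaf); no elementary proof is known. The one-parameter Weil-level
statements of the tree (p117694) do not give it.

What is deliberately NOT here: composite moduli ((3.2)–(3.4) of Heath-Brown are proved in the tree
from this prime case), general `n`.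
-/

noncomputable section

namespace Literature.NumberTheory.Sieve

/-- **Deligne's bound for the hyper-Kloosterman sum `K₂` at primes**: for every prime `p` and
`a₁ a₂ a₃ ∈ (ℤ/p)ˣ` (non-zero residues), `‖K₂(a; p)‖ ≤ 3p`, where
`K₂(a; p) = HeathBrown1986.K2 p a₁ a₂ a₃ = ∑*_{x, y ∈ (ℤ/p)ˣ} e_p(a₁x + a₂y + a₃ x̄ȳ)` (Heath-Brown
1986, (3.1) with `n = 2`, `q = p`: "`|Kₙ(a; p)| ≤ (n+1)p^{n/2}` … due to Deligne"; Smith 1979 Thm. 6;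
Deligne, SGA 4½, Sommes trig. §7). VERBATIM the binder `hD` of
`FouvryTenenbaum2021_lemma413_of_deligne_birchBombieri`; users take
`(hD : Deligne1977_K2_prime_bound)`. Named fact (D-0014), not proved in the tree (ℓ-adic input).
[cite: HeathBrown1986d3, §3 (3.1), case n = 2, q = p prime]
[cite: Smith1979Kloosterman, Thm. 6] [cite: Deligne1977SGA412, Sommes trigonométriques, §7] -/
def Deligne1977_K2_prime_bound : Prop :=
  ∀ (p : ℕ) [Fact p.Prime] (a₁ a₂ a₃ : ZMod p), a₁ ≠ 0 → a₂ ≠ 0 → a₃ ≠ 0 →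
    ‖HeathBrown1986.K2 p a₁ a₂ a₃‖ ≤ 3 * p

end Literature.NumberTheory.Sieve

end
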